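import Summits.ResolutionOfSingularities.ResolutionOfSingularities.Theorems.LossEntryW17
import HarnessLib

/-!
# LossEntryW18 (= lens-3 g29 slice 10, part 2) — walk plumbing of the loss→entry law — (N5) DISCHARGED: straightened walk states keep every axis witness; the fully discharged step laws

decomp-res-lens-3, gen 29 (NODE-g29 §3bis (N5)–(N8)).  TOOL at 0.  Imports `Theorems.LossEntryW17` (§29, isolation transfer).

§30 — (N5) DISCHARGED along the walk: `isolatedTop_deletePthPowers_shear` (`clean(σ_{c,a,τ} F_t)` is isolated for EVERY `τ`),
**`exists_support_pair_lt_straightened`** (THE STRAIGHTENED AXIS LAW: every pair `i ≠ j` has a monomial with `m_i + m_j < q`),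
`wall_le_of_mem_support_straightened`, `exists_thin_straightened`, `polyPts_straightened_nonempty`, `alphaOf_polyPts_straightened_lt_one`,
and the two chain-step laws with ALL polygon inputs discharged:
**`betaOf_polyPts_straightened_succ_alpha_le'`** (α-type step, any `τ`: `ŷ(clean σ_{c,b,τ}F_{t+1}) ≤ ŷ(clean σ_{c,b,τ}F_t)` under the heavy
wall `q ≤ s + r_a`) and **`betaOf_polyPts_straightened_succ_beta_le'`** (β-type step, any re-straightening `τ′`: the new (b;a,c)-ordinate is at most
the ordinate of the `(b_v(c) − τ′b_v(a))`-straightened, `σ_{c,a,τ′}`-translated source; hypotheses = frame bookkeeping + `b_v(a) ≠ 0`,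
`s < q < M+s`, `2q+1 ≤ M+2s` only), and its `τ′ = 0` instance **`betaOf_polyPts_succ_beta_le_wallOrd`** (the plain new ordinate is at most
`LossEpisode.wallOrd W s v a b c` of `LossEntryW12` §20 — hypothesis (h2) at a β-step into an unstraightened phase, fully discharged).
`hLucas` (`q ∣ D`, `q ∤ T` ⇒ `C(D,T) = 0` in `K`) as in slice 4 (discharged from `CharP K p`, `q = p^e` there).
-/

open MvPolynomial Finset
open Literature.AlgebraicGeometry.Resolution
open Literature.AlgebraicGeometry.Resolution.Hauser2010
open Literature.AlgebraicGeometry.Resolution.PointBlowup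
open Summit.ResolutionOfSingularities.ResolutionOfSingularities.Theorems.TightDefectClasses
open Summit.ResolutionOfSingularities.ResolutionOfSingularities.Theorems.TightDefectStrongWalks
open Summit.ResolutionOfSingularities.ResolutionOfSingularities.Theorems.ItineraryCutClasses
open Summit.ResolutionOfSingularities.ResolutionOfSingularities.Theorems.BoundaryLedger
open Summit.ResolutionOfSingularities.ResolutionOfSingularities.Theorems.ProximityCut
open Summit.ResolutionOfSingularities.ResolutionOfSingularities.Theorems.LossExitCone
open Summit.ResolutionOfSingularities.ResolutionOfSingularities.Theorems.LossPolygon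

namespace Summit.ResolutionOfSingularities.ResolutionOfSingularities.Theorems.LossPolygon

open MvPolynomial

variable {K : Type} [Field K]

/-! ## §30 (N5) DISCHARGED — every straightened (re-cleaned) walk state has all axis witnesses; the fully discharged β-step law -/

section StraightenedWitness

variable {q : ℕ} [DecidableEq K] {s₀ : State (Fin 3) K}

/-- **STRAIGHTENED STATES ARE ISOLATED (PROVED):** `clean(σ_{c,a,τ} F_t)` has an isolated top point. [new] -/
theorem isolatedTop_deletePthPowers_shear (W : ForcedWalk q s₀) (t : ℕ) {c a : Fin 3} (hca : c ≠ a) (τ : K)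
    (hLucas : ∀ D T : ℕ, q ∣ D → ¬ q ∣ T → ((D.choose T : ℕ) : K) = 0) :
    IsolatedTop q (deletePthPowers q (shear c a τ (W.st t).F)) :=
  isolatedTop_deletePthPowers hLucas (isolatedTop_shear hca τ (W.isolated t))

/-- **THE STRAIGHTENED AXIS LAW (PROVED; (N5) of NODE-g29):** for every `τ`, every shear `σ_{c,a,τ}` and every pair `i ≠ j`, some monomial of
`clean(σ_{c,a,τ} F_t)` has `m_i + m_j < q`. [new] -/
theorem exists_support_pair_lt_straightened (W : ForcedWalk q s₀) (t : ℕ) {c a : Fin 3} (hca : c ≠ a) (τ : K)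
    (hLucas : ∀ D T : ℕ, q ∣ D → ¬ q ∣ T → ((D.choose T : ℕ) : K) = 0) (i j : Fin 3) (hij : i ≠ j) :
    ∃ m ∈ (deletePthPowers q (shear c a τ (W.st t).F)).support, m i + m j < q :=
  ConeCutAxisLaw.exists_support_pair_lt_of_isolatedTop (isolatedTop_deletePthPowers_shear W t hca τ hLucas) i j hij

/-- The wall letter's exponents are untouched by `σ_{c,b,τ}` and by cleaning. [elementary] -/
theorem wall_le_of_mem_support_straightened (hs : IsRoot q s₀) (W : ForcedWalk q s₀) (t : ℕ) {a b c : Fin 3}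
    (hab : a ≠ b) (hac : a ≠ c) (hbc : b ≠ c) (τ : K) {D : Fin 3 →₀ ℕ}
    (hD : D ∈ (deletePthPowers q (shear c b τ (W.st t).F)).support) : (W.st t).r a ≤ D a := by
  classical
  rw [support_deletePthPowers', Finset.mem_filter] at hD
  obtain ⟨D', hD', n, -, hDE⟩ := exists_shearExp_eq_of_mem_support_shear hab.symm hbc hac τ _ hD.1
  rw [← hDE, shearExp_apply_snd hab.symm hac]
  exact Finsupp.le_def.mp (walk_r hs W t D' hD') a

/-- **(N5) AS USED BY `betaOf_polyPts_straightened_succ_alpha_le` (PROVED):** under a heavy wall `a` (`q ≤ s + r_a`, `r_c = 0`) the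
τ-straightened cleaned equation has a thin monomial, so its polygon in the frame `(a, b ; c)` is NON-EMPTY with `α < 1`. [new] -/
theorem exists_thin_straightened (hs : IsRoot q s₀) (W : ForcedWalk q s₀) (t : ℕ) {a b c : Fin 3} (hab : a ≠ b) (hac : a ≠ c)
    (hbc : b ≠ c) (τ : K) (hLucas : ∀ D T : ℕ, q ∣ D → ¬ q ∣ T → ((D.choose T : ℕ) : K) = 0) {s : ℕ}
    (hq : q ≤ s + (W.st t).r a) (hrc : (W.st t).r c = 0) :
    ∃ D ∈ (deletePthPowers q (shear c b τ (W.st t).F)).support, D c < s + (W.st t).r c ∧ D a + D c < s + (W.st t).r a :=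
  exists_thin_of_isolatedTop hac hrc (isolatedTop_deletePthPowers_shear W t hbc.symm τ hLucas)
    (fun _ hD => wall_le_of_mem_support_straightened hs W t hab hac hbc τ hD) hq

/-- (N5), polygon form: non-empty … [new] -/
theorem polyPts_straightened_nonempty (hs : IsRoot q s₀) (W : ForcedWalk q s₀) (t : ℕ) {a b c : Fin 3} (hab : a ≠ b)
    (hac : a ≠ c) (hbc : b ≠ c) (τ : K) (hLucas : ∀ D T : ℕ, q ∣ D → ¬ q ∣ T → ((D.choose T : ℕ) : K) = 0) {s : ℕ}
    (hq : q ≤ s + (W.st t).r a) (hrc : (W.st t).r c = 0) :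
    (polyPts s (W.st t).r a b c (deletePthPowers q (shear c b τ (W.st t).F))).Nonempty := by
  obtain ⟨D, hD, hDc, -⟩ := exists_thin_straightened hs W t hab hac hbc τ hLucas hq hrc
  exact polyPts_nonempty_of_thin b hD hDc

/-- (N5), polygon form: … with `α < 1`. [new] -/
theorem alphaOf_polyPts_straightened_lt_one (hs : IsRoot q s₀) (W : ForcedWalk q s₀) (t : ℕ) {a b c : Fin 3} (hab : a ≠ b)
    (hac : a ≠ c) (hbc : b ≠ c) (τ : K) (hLucas : ∀ D T : ℕ, q ∣ D → ¬ q ∣ T → ((D.choose T : ℕ) : K) = 0) {s : ℕ}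
    (hq : q ≤ s + (W.st t).r a) (hrc : (W.st t).r c = 0) :
    alphaOf (polyPts s (W.st t).r a b c (deletePthPowers q (shear c b τ (W.st t).F))) < 1 := by
  obtain ⟨D, hD, hDc, hthin⟩ := exists_thin_straightened hs W t hab hac hbc τ hLucas hq hrc
  exact alphaOf_polyPts_lt_one_of_thin b hrc hD hDc hthin

/-- **(h2') AT AN α-TYPE CHAIN STEP, FULLY DISCHARGED (PROVED):** `betaOf_polyPts_straightened_succ_alpha_le` with its inputs (N5)
supplied by isolation transfer: at a move in the chart of the heavy wall letter `a` (`q ≤ s + r_a`, `r_c = 0`), for ANY `τ`,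
`ŷ(clean σ_{c,b,τ} F_{t+1}) ≤ ŷ(clean σ_{c,b,τ} F_t)` in the frame `(a, b ; c)`. [new] -/
theorem betaOf_polyPts_straightened_succ_alpha_le' (hs : IsRoot q s₀) (W : ForcedWalk q s₀) (t : ℕ) {a b c : Fin 3}
    (hab : a ≠ b) (hac : a ≠ c) (hbc : b ≠ c) (hj : W.j t = a)
    (hLucas : ∀ D T : ℕ, q ∣ D → ¬ q ∣ T → ((D.choose T : ℕ) : K) = 0) (τ : K) {s : ℕ}
    (hrb : (W.st (t + 1)).r b = (W.st t).r b) (hra : (W.st (t + 1)).r a + q = s + (W.st t).r a + (W.st t).r b)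
    (hrc : (W.st t).r c = 0) (hrc' : (W.st (t + 1)).r c = 0) (hq : q ≤ s + (W.st t).r a) :
    betaOf (polyPts s (W.st (t + 1)).r a b c (deletePthPowers q (shear c b τ (W.st (t + 1)).F))) ≤
      betaOf (polyPts s (W.st t).r a b c (deletePthPowers q (shear c b τ (W.st t).F))) :=
  betaOf_polyPts_straightened_succ_alpha_le hs W t hab hac hbc hj hLucas τ hrb hra hrc hrc'
    (polyPts_straightened_nonempty hs W t hab hac hbc τ hLucas hq hrc)
    (alphaOf_polyPts_straightened_lt_one hs W t hab hac hbc τ hLucas hq hrc)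

/-- **(h2') AT A β-TYPE CHAIN STEP, FULLY DISCHARGED (PROVED):** `betaOf_polyPts_straightened_succ_beta_le` with the source polygon's
non-emptiness and the axis witness of the new τ′-straightened state BOTH supplied by isolation transfer (§29): for ANY `τ′`,
`ŷ(clean σ_{c,a,τ′} F_{v+1}; (b;a,c)) ≤ ŷ(σ_{c,a,τ′} clean(σ_{c,b,b_v(c)−τ′b_v(a)} F_v); (a;b,c))`. [NODE-g29 (N5)–(N7); new] -/
theorem betaOf_polyPts_straightened_succ_beta_le' (hs : IsRoot q s₀) (W : ForcedWalk q s₀) (v : ℕ) {a b c : Fin 3}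
    (hab : a ≠ b) (hac : a ≠ c) (hbc : b ≠ c) (hj : W.j v = b)
    (hLucas : ∀ D T : ℕ, q ∣ D → ¬ q ∣ T → ((D.choose T : ℕ) : K) = 0) (τ' : K) {s M M' : ℕ} (hoM : q + M' = M + s)
    (hord : ∀ D ∈ (W.st v).F.support, M + s ≤ D.degree) (hrva : (W.st v).r a = M) (hrvb : (W.st v).r b = 0)
    (hrvc : (W.st v).r c = 0) (hr₁b : (W.st (v + 1)).r b = M') (hr₁a : (W.st (v + 1)).r a = 0) (hr₁c : (W.st (v + 1)).r c = 0)
    (hg : W.b v a ≠ 0) (hsq : s < q) (hqo : q < M + s) (hos : 2 * q + 1 ≤ M + s + s) :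
    betaOf (polyPts s (W.st (v + 1)).r b a c (deletePthPowers q (shear c a τ' (W.st (v + 1)).F))) ≤
      betaOf (polyPts s (W.st v).r a b c
        (shear c a τ' (deletePthPowers q (shear c b (W.b v c - τ' * W.b v a) (W.st v).F)))) := by
  classical
  -- degrees of the source and of the translated source
  have hdegG : ∀ D ∈ (shear c a τ' (deletePthPowers q (shear c b (W.b v c - τ' * W.b v a) (W.st v).F))).support,
      M + s ≤ D.degree := by
    intro D hD
    refine le_degree_of_mem_support_shear hab hac hbc _ (fun D' hD' => ?_) hD
    rw [support_deletePthPowers', Finset.mem_filter] at hD'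
    exact le_degree_of_mem_support_shear hab.symm hbc hac _ hord hD'.1
  have hH : ∀ E ∈ (shear a b (W.b v a)
      (shear c a τ' (deletePthPowers q (shear c b (W.b v c - τ' * W.b v a) (W.st v).F)))).support, q ≤ E.degree :=
    fun E hE => le_trans hqo.le (le_degree_of_mem_support_shear hbc hab.symm hac.symm _ hdegG hE)
  -- the source polygon is non-empty (isolation transfer + wall divisibility)
  have hisoG : IsolatedTop q (shear c a τ' (deletePthPowers q (shear c b (W.b v c - τ' * W.b v a) (W.st v).F))) :=
    isolatedTop_shear hac.symm τ' (isolatedTop_deletePthPowers_shear W v hbc.symm _ hLucas)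
  have hwallG : ∀ D ∈ (shear c a τ' (deletePthPowers q (shear c b (W.b v c - τ' * W.b v a) (W.st v).F))).support,
      (W.st v).r a ≤ D a := by
    intro D hD
    obtain ⟨D', hD', n, -, hDE⟩ := exists_shearExp_eq_of_mem_support_shear hab hac hbc τ' _ hD
    rw [← hDE, shearExp_apply_fst hab hac]
    exact le_trans (wall_le_of_mem_support_straightened hs W v hab hac hbc _ hD') (Nat.le_add_right _ _)
  have hq' : q ≤ s + (W.st v).r a := by rw [hrva]; omega
  obtain ⟨D, hD, hDc, -⟩ := exists_thin_of_isolatedTop hac hrvc hisoG hwallG hq'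
  have hne := polyPts_nonempty_of_thin (a := a) b hD hDc
  -- the axis witness of the new τ′-straightened state, pulled back through the chart
  obtain ⟨m, hm, hmlt⟩ := exists_support_pair_lt_straightened W (v + 1) hac.symm τ' hLucas b c hbc
  rw [deletePthPowers_shear_succ_beta hs W v hab hac hbc hj hLucas τ', support_deletePthPowers_chartTransform b _ hH,
    Finset.mem_image] at hm
  obtain ⟨R, hRf, hRm⟩ := hm
  rw [Finset.mem_filter] at hRf
  have hR : R ∈ (deletePthPowers q (shear a b (W.b v a)
      (shear c a τ' (deletePthPowers q (shear c b (W.b v c - τ' * W.b v a) (W.st v).F))))).support := by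
    rw [support_deletePthPowers', Finset.mem_filter]; exact hRf
  have hqR : q ≤ R.degree := hH R hRf.1
  rw [← hRm, chartExponent_apply, if_pos rfl, chartExponent_apply, if_neg (Ne.symm hbc)] at hmlt
  have hax : R.degree + R c < 2 * q := by omega
  exact betaOf_polyPts_straightened_succ_beta_le hs W v hab hac hbc hj hLucas τ' hoM hord hrva hrvb hrvc hr₁b hr₁a hr₁c hg
    hsq hqo hos hne hR hax

/-- **THE β-STEP INTO AN UNSTRAIGHTENED PHASE (PROVED; `τ′ = 0`):** after a β-type chain step at `v` (chart `b ≠ a = wall`, `b_v(a) ≠ 0`)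
the plain `(b; a, c)`-ordinate of the new one-wall state is at most the τ-STRAIGHTENED WALL ORDINATE `wallOrd W s v a b c` of the old
one (`τ = b_v(c)`, the move's own third translation) — hypothesis (h2) of `lawLossEntryAt_of_wallSteps'` at a β-step whose next phase
needs no re-straightening, with every polygon input discharged. [NODE-g29 (N7); new] -/
theorem betaOf_polyPts_succ_beta_le_wallOrd (hs : IsRoot q s₀) (W : ForcedWalk q s₀) (v : ℕ) {a b c : Fin 3}
    (hab : a ≠ b) (hac : a ≠ c) (hbc : b ≠ c) (hj : W.j v = b)
    (hLucas : ∀ D T : ℕ, q ∣ D → ¬ q ∣ T → ((D.choose T : ℕ) : K) = 0) {s M M' : ℕ} (hoM : q + M' = M + s)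
    (hord : ∀ D ∈ (W.st v).F.support, M + s ≤ D.degree) (hrva : (W.st v).r a = M) (hrvb : (W.st v).r b = 0)
    (hrvc : (W.st v).r c = 0) (hr₁b : (W.st (v + 1)).r b = M') (hr₁a : (W.st (v + 1)).r a = 0) (hr₁c : (W.st (v + 1)).r c = 0)
    (hg : W.b v a ≠ 0) (hsq : s < q) (hqo : q < M + s) (hos : 2 * q + 1 ≤ M + s + s) :
    betaOf (polyPts s (W.st (v + 1)).r b a c (W.st (v + 1)).F) ≤ LossEpisode.wallOrd W s v a b c := by
  have h := betaOf_polyPts_straightened_succ_beta_le' hs W v hab hac hbc hj hLucas 0 hoM hord hrva hrvb hrvc hr₁b hr₁a hr₁c hg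
    hsq hqo hos
  simp only [zero_mul, sub_zero, shear_zero] at h
  have hstep : (W.st (v + 1)).F =
      deletePthPowers q (PointBlowup.translate (W.b v) (chartTransform q (W.j v) (W.st v).F)) := by
    rw [W.st_succ]; rfl
  have hclean : deletePthPowers q (W.st (v + 1)).F = (W.st (v + 1)).F := by
    rw [hstep, ItineraryCutClasses.deletePthPowers_idem]
  rw [hclean] at h
  exact h

end StraightenedWitness

end Summit.ResolutionOfSingularities.ResolutionOfSingularities.Theorems.LossPolygon
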